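import Literature.MathematicalPhysics.QuantumFieldTheory.Federbush1986.LandauModeWeakEulerLagrange
import Mathlib.Analysis.Complex.RemovableSingularity

/-!
# `Federbush1986.LandauModeMultiplierTube` — [Federbush1986PhaseCellI] §3 (3.4)/(3.11) (Lagrange multipliers of the constrained
# minimisation) with [FederbushWilliamson1987PhaseCellII] §III «analytic in D_L^{ε₀}» — THE MULTIPLIER `Λ_ν` OF `p²A′_ν = Λ_ν b̂_ν`
# EXTENDS ANALYTICALLY AND BOUNDEDLY TO A COMPLEX TUBE OVER THE MOMENTUM CELL: `Λ_ν = N_ν/((1/2π)² D_ν)` with the lattice sums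
# `N_ν = Σ_n Ĵ_ν b̂*_ν(· + 2πn)`, `D_ν = Σ_n b̂_ν b̂*_ν(· + 2πn)` analytic on the tube and `|D_ν| ≥ ½(2/π)^{10}` there

statement-level skeleton of published theorems with citation tags; proofs where landed; nothing here is a claim about the Yang–Mills mass gap

CITATION HEADER.  P. Federbush, *A phase cell approach to Yang–Mills theory. I. Modes, lattice-continuum duality*, Commun.
Math. Phys. **107** (1986) 319–329 [Federbush1986PhaseCellI]; P. Federbush, C. Williamson, *… II. Analysis of a mode*, J. Math.
Phys. **28** (1987) 1416–1419 [FederbushWilliamson1987PhaseCellII] (§III p. 1417 «We make the preliminary observation that f_i, D, 𝒟,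
and ⟨·⟩ are periodic functions of p», Theorems 3.2–3.3; §VI (6.6)–(6.8) p. 1418, the lattice sums K_ρ with «We easily see, for p in 𝒟_L, that
|K_ρ(p)| < m»); L. Hörmander, *An Introduction to Complex Analysis in
Several Variables* (1973) §2.2 (Weierstrass theorem; the tree's `Literature.Analysis.Complex.SCV.analyticOnNhd_tsum_of_summable_norm`).
Unit `lit-balaban-r17` gen 12 (fold owner of the Federbush block; own lane `Federbush1986/`), SKELETON rows **F1.Eq3.2-3.12**
((3.4)/(3.11) multipliers), **F2.Thm3.1-3.3** / **F2.Eq3.1-3.5** (analyticity on the tube, used), **F1.Eq3.1** (consumer chain: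
exponential decay of the bond multipliers ⇒ general competitor of `hmin`); heads unchanged.  HOME `run/shared/lean/pub/lit-balaban/`.
Uses p04's corrected mode (`ghat`, `ghat_pack`: analytic on `𝒟_G(δ₀)`, II Theorem 3.3 bound on `𝒟_B(δ₀)`) and r17 gen 11–12's
`LandauModeMultipliers` / `LandauModeWeakEulerLagrange`.

THE PRINT (verbatim; page images `run/shared/lean/pub/pub-balaban/t4/b2b-balaban-t4-lit2/g7/fw1987II/fedwill1987-jmp28-II-p002/p003-x2.png`).
II p. 1417 §III: *«We take the analytic extensions of the expressions in Sec. II from real p to complex p. … We make the preliminary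
observation that f_i, D, 𝒟, and ⟨·⟩ are periodic functions of p, invariant under p → p + 2πn (3.1) (n is a four-vector with integer
components). We note that r_L, p², and p_i are not periodic functions of p.»*; *«Theorem 3.2 (Global analyticity): A^N_i(p) is analytic
in the domain, 𝒟_G, specified by |Im p_j| < ε₀. (3.3)  Theorem 3.3 (Boundedness): Within the domain, 𝒟_B, specified by |Im p_j| < ε₀/2,
(3.4) A^N_i(p) satisfies bounds of the form |A^N_i(p)| < c ∏_j (1/(|p_j| + 1)) (1/(|p²| + 1)). (3.5)»*; II p. 1418 §VI: *«K_ρ(p) =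
Σ_{n∼ρ} (1/(p + 2πn)²) ∏_{i∉ρ} 1/(p_i + 2πn_i)² (6.6) … We easily see, for p in 𝒟_L, that |K_ρ(p)| < m, |K¹_ρ(p)| < m, (6.8) for some
fixed m.»*  I p. 327: *«(Alternatively one could use Lagrange multipliers.)»*, p. 328 (3.11).  (v1.1 DOCFIX, r17 gen 13 quotation audit;
declarations untouched: the v1 block rendered §III as «We note that all the functions … are periodic … It is easy to show that the lattice
sums [such as in (1.4)] converge to analytic functions» and (6.8) as a bound on `1/(p + 2πn)²` — paraphrases, not printed sentences; the
analyticity of the lattice sums on a tube is THIS MODULE's Weierstrass-theorem step, print's counterpart being (6.6)–(6.8).)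

THE ARGUMENT (ours).  On the real momenta off the lattice hyperplanes `Ĵ_ν := p²ĝ_ν − p_ν(p·ĝ) = (1/2π)² Λ_ν b̂_ν` (Landau gauge),
`Λ_ν` `2π`-periodic.  Multiply by `b̂*_ν := conj b̂_ν` and periodise: `N_ν(p) := Σ_n Ĵ_ν b̂*_ν(p + 2πn) = (1/2π)² Λ_ν(p) D_ν(p)`,
`D_ν(p) := Σ_n |b̂_ν(p + 2πn)|² ≥ |b̂_ν(p + 2πn₀)|² ≥ (2/π)^{10}` (the shift into `[−π, π]⁴`; Jordan's inequality).  Both lattice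
sums are sums of functions analytic on the tube `T_{κ₀} = {|Im z_j| < κ₀}`, `κ₀ = min(δ₀/2, 1/2)` — `ĝ` by II Theorem 3.2 (p04),
`b̂_ν`, `b̂*_ν` entire (products of `(e^{iw} − 1)/w`) — with the summable majorant `C ∏_j (1 + |Re z_j + 2πn_j|)⁻²` from II
Theorem 3.3's bound and `|(e^{iw} − 1)/w| ≤ 8(1 + |Re w|)⁻¹` on the unit strip; Weierstrass gives analyticity.  Uniform continuity
of `D_ν` on a compact piece of the tube keeps `|D_ν| ≥ ½(2/π)^{10}` on a thinner tube over the box `|Re z_j| ≤ 9 ⊃ [0, 2π]`, so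
`Λ̃_ν := N_ν/((1/2π)² D_ν)` is analytic and bounded there, `2πℤ⁴`-periodic, and equals `Λ_ν` on the reals.

WHAT IS PROVED (kernel-checked; `def`s with bodies; no `Prop`-valued definition, no named fact, no `sorry`).
* §1 `PlaquetteGram.sincI` (`dslope` of `e^{iw}` at `0`): `sincI_of_ne_zero`, `sincI_zero`, **`differentiable_sincI`** (entire),
  `norm_sincI_le` (`≤ e^{|Im w|} + 1`), `norm_sincI_le_div`, **`norm_sincI_le_inv`** (`≤ 8(1+|Re w|)⁻¹` on the unit strip),
  `norm_sq_cexp_I_sub_one`, **`two_div_pi_le_norm_sincI`** (`≥ 2/π` on `[−π, π]`), `conj_sincI_neg_real`.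
* §2 **`bondFactorE`**, **`bondFactorS`** (entire), `bondFactorE_toC` (`= bondFactor` off the hyperplanes), **`bondFactorS_toC_eq_conj`**,
  `bondFactorE_mul_bondFactorS_toC` (`= |b̂_ν|²`), `differentiable_bondFactorE/S`, `reProd`, **`norm_bondFactorS_le`** /
  `norm_bondFactorE_le` (`≤ 8⁵ reProd`), **`norm_bondFactorE_toC_ge`** (`≥ (2/π)⁵` on `[−π,π]⁴`).
* §3 `CorrectedMode.JhatC`, **`JhatC_toC`** (`= (1/2π)²Λ_νb̂_ν`), `differentiableOn_JhatC` (on `𝒟_G(δ₀)`), `kap0` (+ lemmas),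
  `norm_mul_norm_le_two_mul`, **`exists_norm_JhatC_le`** (`|Ĵ_ν| ≤ C reProd` on `T_{κ₀}`).
* §4 `Nterm`, `Dterm`, **`Nsum`**, **`Dsum`**, `Nsum_shift`/`Dsum_shift` (periodicity), `boxTube`, `isOpen_boxTube`, **`inv_sq_le_b`**,
  `reProd_shift_sq_le`, `norm_Nterm_le`, `norm_Dterm_le`, `differentiableOn_Nterm`, `differentiable_Dterm`,
  **`analyticOnNhd_Nsum_boxTube`**, **`analyticOnNhd_Dsum_boxTube`**, **`analyticOnNhd_Nsum`**, **`analyticOnNhd_Dsum`** (on `T_{κ₀}`),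
  `exists_norm_Nsum_le`; real values: `DsumR`, `Dterm_toC`, `summable_DsumR`, **`Dsum_toC`**, **`DsumR_ge`** (`≥ (2/π)^{10}`),
  `norm_Dsum_toC_ge`, `Dsum_toC_ne_zero`, `Nterm_toC`, **`Nsum_toC`** (`N_ν = (1/2π)²Λ_νD_ν` on the reals off the hyperplanes).
* §5 `continuous_shiftI_uncurry`, `dist_shiftI_toC_lt`, **`exists_norm_Dsum_shiftI_ge`** (`|D_ν(p + iτ)| ≥ ½(2/π)^{10}` for
  `|p_j| ≤ 9`, `|τ_j| ≤ κ₁`).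
* §6 **`LamT`** (`Λ̃_ν = N_ν/((1/2π)²D_ν)`), **`LamT_toC`** (`= Λ_ν` on the reals off the hyperplanes), `LamT_shift` (periodic),
  `shiftI_re_im`, **`exists_LamT_analytic_bounded`** (complex-differentiable and bounded on `boxTube 9 κ₁`, `D_ν` bounded below).

HONEST SCOPE.  (a) Nothing here is print's statement: II proves analyticity of `A^N` (Theorem 3.2); this file transports it to the
multiplier `Λ_ν` through the gauge-invariant current `Ĵ_ν` and a positive periodisation — our device for the decay of the bond
multipliers (next file).  (b) The widths `κ₀`, `κ₁` and all constants are existential (`κ₁` from uniform continuity), not computed.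
(c) `Λ̃_ν` is defined everywhere by the quotient formula; it is used only on `boxTube 9 κ₁` and on the reals.  (d) The mode is p04's
corrected-gauge mode `gcorr`/`ghat`; `Ĵ_ν`, `N_ν`, `D_ν`, `Λ̃_ν` are gauge-independent in value on the reals but defined through
`ghat s`.  Axioms standard.
-/

namespace Literature.MathematicalPhysics.QuantumFieldTheory.Federbush1986

noncomputable section

open Complex ModeAnalyticity Filter Topology MeasureTheory Set
open scoped BigOperators ComplexConjugate FourierTransform RealInnerProductSpace ContDiff

namespace PlaquetteGram

open ModeDecay (toC phase shiftI)

/-! ## §1 The entire function `(e^{iw} − 1)/w` -/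

/-- `sincI w = (e^{iw} − 1)/w`, extended by its value `i` at `w = 0` (Mathlib's `dslope`): the building block of the bond
transform `b̂_ν` (I (2.2), (3.10): the factors `(i/p_k)(e^{−ip_k} − 1)` and `(1 − e^{−ip_i})²/p_i²`) as an ENTIRE function.
[cite: Federbush1986PhaseCellI, (3.10) p. 328; FederbushWilliamson1987PhaseCellII, (1.5)–(1.7) p. 1416, §III p. 1417] -/
def sincI : ℂ → ℂ := dslope (fun w => cexp (I * w)) 0

/-- Off the origin `sincI w = (e^{iw} − 1)/w`. [cite: FederbushWilliamson1987PhaseCellII, (1.7) p. 1416] -/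
theorem sincI_of_ne_zero {w : ℂ} (hw : w ≠ 0) : sincI w = (cexp (I * w) - 1) / w := by
  rw [sincI, dslope_of_ne _ hw, slope_def_field]
  simp

/-- `sincI 0 = i`. [cite: FederbushWilliamson1987PhaseCellII, §III p. 1417] -/
theorem sincI_zero : sincI 0 = I := by
  rw [sincI, dslope_same]
  have h : HasDerivAt (fun w : ℂ => cexp (I * w)) (cexp (I * 0) * (I * 1)) 0 :=
    (Complex.hasDerivAt_exp (I * 0)).comp (0 : ℂ) ((hasDerivAt_id (0 : ℂ)).const_mul I)
  rw [h.deriv]; simp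

/-- **`sincI` is entire** (removable singularity). [cite: FederbushWilliamson1987PhaseCellII, §III p. 1417 («f̄_i → e^{ip_i} − 1 … analytic»)] -/
theorem differentiable_sincI : Differentiable ℂ sincI := by
  have h : DifferentiableOn ℂ (fun w : ℂ => cexp (I * w)) Set.univ := by fun_prop
  have := (Complex.differentiableOn_dslope (Filter.univ_mem : (Set.univ : Set ℂ) ∈ 𝓝 (0 : ℂ))).mpr h
  exact differentiableOn_univ.mp this

/-- `sincI` is continuous. [cite: FederbushWilliamson1987PhaseCellII, §III p. 1417] -/
theorem continuous_sincI : Continuous sincI := differentiable_sincI.continuous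

/-- `|e^{iw}| = e^{−Im w}`. [folklore] -/
private theorem norm_cexp_I_mul (w : ℂ) : ‖cexp (I * w)‖ = Real.exp (-w.im) := by
  rw [Complex.norm_exp]; simp

/-- **Upper bound on the strip**: `|sincI w| ≤ e^{|Im w|} + 1` everywhere. [cite: FederbushWilliamson1987PhaseCellII, §III p. 1417, (6.8) p. 1418] -/
theorem norm_sincI_le (w : ℂ) : ‖sincI w‖ ≤ Real.exp |w.im| + 1 := by
  have he : 1 ≤ Real.exp |w.im| := Real.one_le_exp (abs_nonneg _)
  by_cases hw : w = 0
  · rw [hw, sincI_zero, Complex.norm_I]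
    have : 1 ≤ Real.exp |(0 : ℂ).im| := Real.one_le_exp (abs_nonneg _)
    linarith
  by_cases h1 : ‖w‖ ≤ 1
  · -- `|e^{iw} − 1| ≤ 2|iw|`
    rw [sincI_of_ne_zero hw, norm_div]
    have h := Complex.norm_exp_sub_one_le (x := I * w) (by rwa [norm_mul, Complex.norm_I, one_mul])
    rw [norm_mul, Complex.norm_I, one_mul] at h
    rw [div_le_iff₀ (norm_pos_iff.mpr hw)]
    nlinarith [norm_nonneg w]
  · rw [not_le] at h1
    rw [sincI_of_ne_zero hw, norm_div]
    calc ‖cexp (I * w) - 1‖ / ‖w‖ ≤ ‖cexp (I * w) - 1‖ / 1 := by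
          exact div_le_div_of_nonneg_left (norm_nonneg _) one_pos h1.le
      _ ≤ ‖cexp (I * w)‖ + ‖(1 : ℂ)‖ := by rw [div_one]; exact norm_sub_le _ _
      _ ≤ Real.exp |w.im| + 1 := by
          rw [norm_cexp_I_mul, norm_one]
          exact add_le_add (Real.exp_le_exp.mpr (neg_le_abs _)) le_rfl

/-- **Decay along the strip**: `|sincI w| ≤ (e^{|Im w|} + 1)/|w|` for `|w| ≥ 1`. [cite: FederbushWilliamson1987PhaseCellII, (6.8) p. 1418] -/
theorem norm_sincI_le_div {w : ℂ} (h1 : 1 ≤ ‖w‖) : ‖sincI w‖ ≤ (Real.exp |w.im| + 1) / ‖w‖ := by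
  have hw : w ≠ 0 := fun h => by rw [h, norm_zero] at h1; exact absurd h1 (by norm_num)
  rw [sincI_of_ne_zero hw, norm_div]
  refine div_le_div_of_nonneg_right ?_ (norm_nonneg _)
  calc ‖cexp (I * w) - 1‖ ≤ ‖cexp (I * w)‖ + ‖(1 : ℂ)‖ := norm_sub_le _ _
    _ ≤ Real.exp |w.im| + 1 := by
        rw [norm_cexp_I_mul, norm_one]
        exact add_le_add (Real.exp_le_exp.mpr (neg_le_abs _)) le_rfl

/-- **The working bound on the unit strip** `|Im w| ≤ 1`: `|sincI w| ≤ 8 (1 + |Re w|)⁻¹`. [cite: FederbushWilliamson1987PhaseCellII, (6.8) p. 1418] -/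
theorem norm_sincI_le_inv {w : ℂ} (hw : |w.im| ≤ 1) : ‖sincI w‖ ≤ 8 * (1 + |w.re|)⁻¹ := by
  have he : Real.exp |w.im| + 1 ≤ 4 := by
    have := Real.exp_le_exp.mpr hw
    have h3 : Real.exp 1 < 3 := lt_trans Real.exp_one_lt_d9 (by norm_num)
    linarith
  have hre : |w.re| ≤ ‖w‖ := Complex.abs_re_le_norm w
  by_cases h1 : ‖w‖ ≤ 1
  · have hpos : 0 < 1 + |w.re| := by positivity
    calc ‖sincI w‖ ≤ 4 := (norm_sincI_le w).trans he
      _ ≤ 8 * (1 + |w.re|)⁻¹ := by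
          rw [← div_eq_mul_inv, le_div_iff₀ hpos]; nlinarith [abs_nonneg w.re]
  · rw [not_le] at h1
    have hpos : 0 < ‖w‖ := by linarith
    calc ‖sincI w‖ ≤ (Real.exp |w.im| + 1) / ‖w‖ := norm_sincI_le_div h1.le
      _ ≤ 4 / ‖w‖ := div_le_div_of_nonneg_right he hpos.le
      _ ≤ 8 * (1 + |w.re|)⁻¹ := by
          rw [← div_eq_mul_inv, div_le_div_iff₀ hpos (by positivity)]
          nlinarith [abs_nonneg w.re]

/-- `|e^{iq} − 1|² = 2 − 2cos q` for real `q`. [cite: FederbushWilliamson1987PhaseCellII, (1.1) p. 1416] -/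
theorem norm_sq_cexp_I_sub_one (q : ℝ) : ‖cexp (I * (q : ℂ)) - 1‖ ^ 2 = 2 - 2 * Real.cos q := by
  rw [show I * (q : ℂ) = (q : ℂ) * I by ring, Complex.exp_mul_I]
  rw [← Complex.ofReal_cos, ← Complex.ofReal_sin]
  rw [Complex.sq_norm, Complex.normSq_apply]
  simp only [sub_re, add_re, ofReal_re, mul_re, ofReal_im, I_re, I_im, one_re, sub_im, add_im, mul_im, one_im]
  nlinarith [Real.sin_sq_add_cos_sq q]

/-- **Lower bound on the real period**: `|sincI q| ≥ 2/π` for real `|q| ≤ π` (Jordan's inequality `sin x ≥ (2/π)x`).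
[cite: FederbushWilliamson1987PhaseCellII, §V p. 1418 («positivity … on the unit cell»)] -/
theorem two_div_pi_le_norm_sincI {q : ℝ} (hq : |q| ≤ Real.pi) : 2 / Real.pi ≤ ‖sincI (q : ℂ)‖ := by
  have hπ := Real.pi_pos
  by_cases hq0 : q = 0
  · rw [hq0, Complex.ofReal_zero, sincI_zero, Complex.norm_I]
    rw [div_le_one hπ]; linarith [Real.pi_gt_three]
  have hqC : (q : ℂ) ≠ 0 := Complex.ofReal_ne_zero.mpr hq0
  rw [sincI_of_ne_zero hqC, norm_div, Complex.norm_real, Real.norm_eq_abs]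
  -- `|e^{iq} − 1| = 2|sin(q/2)|`
  have hsq : ‖cexp (I * (q : ℂ)) - 1‖ ^ 2 = (2 * Real.sin (q / 2)) ^ 2 := by
    have hc : Real.cos q = 1 - 2 * Real.sin (q / 2) ^ 2 := by
      have h := Real.cos_two_mul (q / 2)
      rw [show 2 * (q / 2) = q by ring] at h
      nlinarith [Real.sin_sq_add_cos_sq (q / 2)]
    rw [norm_sq_cexp_I_sub_one, hc]
    ring
  have hn : ‖cexp (I * (q : ℂ)) - 1‖ = 2 * |Real.sin (q / 2)| := by
    have h1 : 0 ≤ ‖cexp (I * (q : ℂ)) - 1‖ := norm_nonneg _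
    have h2 : 0 ≤ 2 * |Real.sin (q / 2)| := by positivity
    have : (2 * |Real.sin (q / 2)|) ^ 2 = (2 * Real.sin (q / 2)) ^ 2 := by rw [mul_pow, mul_pow, sq_abs]
    nlinarith [sq_nonneg (‖cexp (I * (q : ℂ)) - 1‖ - 2 * |Real.sin (q / 2)|),
      sq_nonneg (‖cexp (I * (q : ℂ)) - 1‖ + 2 * |Real.sin (q / 2)|)]
  rw [hn]
  -- Jordan on `x = |q|/2 ∈ [0, π/2]`
  have hx0 : 0 ≤ |q| / 2 := by positivity
  have hx1 : |q| / 2 ≤ Real.pi / 2 := by linarith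
  have hj := Real.mul_le_sin hx0 hx1
  have hsin : |Real.sin (q / 2)| = Real.sin (|q| / 2) := by
    have hqπ : q ≤ Real.pi := (le_abs_self q).trans hq
    have hqπ' : -Real.pi ≤ q := by linarith [neg_abs_le q]
    rcases le_or_gt 0 q with h | h
    · rw [abs_of_nonneg h, abs_of_nonneg (Real.sin_nonneg_of_nonneg_of_le_pi (by positivity) (by linarith))]
    · rw [abs_of_neg h, show -q / 2 = -(q / 2) by ring, Real.sin_neg]
      have : Real.sin (q / 2) ≤ 0 := by
        rw [show q / 2 = -(-q / 2) by ring, Real.sin_neg, neg_nonpos]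
        exact Real.sin_nonneg_of_nonneg_of_le_pi (by linarith) (by linarith)
      rw [abs_of_nonpos this]
  rw [hsin, le_div_iff₀ (abs_pos.mpr hq0)]
  calc 2 / Real.pi * |q| = 2 * (2 / Real.pi * (|q| / 2)) := by ring
    _ ≤ 2 * Real.sin (|q| / 2) := by linarith

/-- On the reals `conj (sincI (−q)) = −sincI q`. [cite: FederbushWilliamson1987PhaseCellII, (1.5) p. 1416 (f̄ is the conjugate of f)] -/
theorem conj_sincI_neg_real (q : ℝ) : conj (sincI (-(q : ℂ))) = -sincI (q : ℂ) := by
  by_cases hq : q = 0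
  · rw [hq, Complex.ofReal_zero, neg_zero, sincI_zero, Complex.conj_I]
  have hqC : (q : ℂ) ≠ 0 := Complex.ofReal_ne_zero.mpr hq
  rw [sincI_of_ne_zero (neg_ne_zero.mpr hqC), sincI_of_ne_zero hqC, map_div₀, map_sub, map_one, ← Complex.exp_conj,
    map_mul, Complex.conj_I, map_neg, Complex.conj_ofReal]
  have hmq : (-(q : ℂ)) ≠ 0 := neg_ne_zero.mpr hqC
  field_simp

/-! ## §2 The bond transform `b̂_ν` and its conjugate `b̂*_ν` as ENTIRE functions on `ℂ⁴` -/

/-- **`b̂_ν` as an entire function**: `b̂_ν(z) = ∏_{k≠ν}(−i·sincI(−z_k)) · (−sincI(−z_ν)²)` (`= bondFactor ν` on the real momenta off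
the coordinate hyperplanes). [cite: Federbush1986PhaseCellI, (2.2) p. 325, (3.10) p. 328; FederbushWilliamson1987PhaseCellII, (1.7) p. 1416, §III p. 1417] -/
def bondFactorE (ν : Fin 4) (z : Momentum) : ℂ :=
  (∏ k ∈ Finset.univ.erase ν, -I * sincI (-z k)) * (-(sincI (-z ν)) ^ 2)

/-- **`b̂*_ν`, the analytic extension of `conj b̂_ν` from the reals**: `b̂*_ν(z) = ∏_{k≠ν}(−i·sincI(z_k)) · (−sincI(z_ν)²)`.
[cite: FederbushWilliamson1987PhaseCellII, (1.5) p. 1416, §III p. 1417 («f̄_i → e^{ip_i} − 1»)] -/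
def bondFactorS (ν : Fin 4) (z : Momentum) : ℂ :=
  (∏ k ∈ Finset.univ.erase ν, -I * sincI (z k)) * (-(sincI (z ν)) ^ 2)

/-- `b̂_ν(p) = bondFactor ν p` at real momenta with all `p_k ≠ 0`. [cite: FederbushWilliamson1987PhaseCellII, (1.7) p. 1416] -/
theorem bondFactorE_toC {p : Fin 4 → ℝ} (hp : ∀ k, p k ≠ 0) (ν : Fin 4) : bondFactorE ν (toC p) = bondFactor ν p := by
  have hk : ∀ k, -I * sincI (-toC p k) = I * (cexp (-I * p k) - 1) / p k := fun k => by
    have hpk : (p k : ℂ) ≠ 0 := Complex.ofReal_ne_zero.mpr (hp k)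
    rw [toC_apply, sincI_of_ne_zero (neg_ne_zero.mpr hpk)]
    field_simp
  have hν : -(sincI (-toC p ν)) ^ 2 = -(1 - cexp (-I * p ν)) ^ 2 / (p ν : ℂ) ^ 2 := by
    have hpν : (p ν : ℂ) ≠ 0 := Complex.ofReal_ne_zero.mpr (hp ν)
    rw [toC_apply, sincI_of_ne_zero (neg_ne_zero.mpr hpν)]
    field_simp
    ring_nf
  unfold bondFactorE bondFactor
  rw [hν]
  congr 1
  exact Finset.prod_congr rfl fun k _ => hk k

/-- **On the reals `b̂*_ν = conj b̂_ν`** (all real momenta). [cite: FederbushWilliamson1987PhaseCellII, (1.5) p. 1416] -/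
theorem bondFactorS_toC_eq_conj (ν : Fin 4) (p : Fin 4 → ℝ) : bondFactorS ν (toC p) = conj (bondFactorE ν (toC p)) := by
  unfold bondFactorS bondFactorE
  simp only [toC_apply, map_mul, map_prod, map_neg, map_pow, Complex.conj_I, conj_sincI_neg_real]
  congr 1
  · exact Finset.prod_congr rfl fun k _ => by ring
  · ring

/-- `b̂_ν · b̂*_ν = |b̂_ν|²` on the reals. [cite: FederbushWilliamson1987PhaseCellII, (1.5)–(1.7) p. 1416] -/
theorem bondFactorE_mul_bondFactorS_toC (ν : Fin 4) (p : Fin 4 → ℝ) :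
    bondFactorE ν (toC p) * bondFactorS ν (toC p) = ((‖bondFactorE ν (toC p)‖ ^ 2 : ℝ) : ℂ) := by
  rw [bondFactorS_toC_eq_conj, Complex.mul_conj, Complex.normSq_eq_norm_sq]

/-- The coordinate maps `z ↦ ±z_k` composed with `sincI` are entire. [cite: FederbushWilliamson1987PhaseCellII, §III p. 1417] -/
theorem differentiable_sincI_apply (k : Fin 4) : Differentiable ℂ fun z : Momentum => sincI (z k) :=
  differentiable_sincI.comp (differentiable_apply k)

/-- (idem, reflected coordinate) [cite: FederbushWilliamson1987PhaseCellII, §III p. 1417] -/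
theorem differentiable_sincI_neg_apply (k : Fin 4) : Differentiable ℂ fun z : Momentum => sincI (-z k) :=
  differentiable_sincI.comp (differentiable_apply k).neg

/-- Finite products of entire functions on `ℂ⁴` are entire. [folklore] -/
private theorem differentiable_prod {ι : Type*} [DecidableEq ι] (u : Finset ι) {g : ι → Momentum → ℂ}
    (hg : ∀ i ∈ u, Differentiable ℂ (g i)) : Differentiable ℂ fun z => ∏ i ∈ u, g i z := fun x =>
  (HasFDerivAt.finsetProd (fun i hi => ((hg i hi) x).hasFDerivAt)).differentiableAt

/-- **`b̂_ν` is entire on `ℂ⁴`.** [cite: FederbushWilliamson1987PhaseCellII, §III p. 1417] -/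
theorem differentiable_bondFactorE (ν : Fin 4) : Differentiable ℂ (bondFactorE ν) := by
  have h1 : Differentiable ℂ fun z : Momentum => ∏ k ∈ Finset.univ.erase ν, -I * sincI (-z k) :=
    differentiable_prod _ fun k _ => (differentiable_sincI_neg_apply k).const_mul _
  unfold bondFactorE
  exact h1.mul ((differentiable_sincI_neg_apply ν).pow 2).neg

/-- **`b̂*_ν` is entire on `ℂ⁴`.** [cite: FederbushWilliamson1987PhaseCellII, §III p. 1417] -/
theorem differentiable_bondFactorS (ν : Fin 4) : Differentiable ℂ (bondFactorS ν) := by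
  have h1 : Differentiable ℂ fun z : Momentum => ∏ k ∈ Finset.univ.erase ν, -I * sincI (z k) :=
    differentiable_prod _ fun k _ => (differentiable_sincI_apply k).const_mul _
  unfold bondFactorS
  exact h1.mul ((differentiable_sincI_apply ν).pow 2).neg

/-- The real-momentum majorant `Π_j (1 + |Re z_j|)⁻¹`. [cite: FederbushWilliamson1987PhaseCellII, (3.5) p. 1417, (6.8) p. 1418] -/
def reProd (z : Momentum) : ℝ := ∏ j, (1 + |(z j).re|)⁻¹

/-- `0 ≤ reProd z ≤ 1`. [cite: FederbushWilliamson1987PhaseCellII, (6.8) p. 1418] -/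
theorem reProd_nonneg (z : Momentum) : 0 ≤ reProd z := Finset.prod_nonneg fun j _ => by positivity

/-- **`|b̂*_ν(z)| ≤ 8⁵ Π_j(1 + |Re z_j|)⁻¹` on the unit strip** `|Im z_j| ≤ 1`. [cite: FederbushWilliamson1987PhaseCellII, (6.8) p. 1418] -/
theorem norm_bondFactorS_le {z : Momentum} (hz : ∀ j, |(z j).im| ≤ 1) (ν : Fin 4) :
    ‖bondFactorS ν z‖ ≤ 8 ^ 5 * reProd z := by
  have hs : ∀ k, ‖sincI (z k)‖ ≤ 8 * (1 + |(z k).re|)⁻¹ := fun k => norm_sincI_le_inv (hz k)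
  have hs1 : ∀ k, ‖sincI (z k)‖ ≤ 8 := fun k => (hs k).trans (by
    have : (1 + |(z k).re|)⁻¹ ≤ 1 := inv_le_one_of_one_le₀ (by linarith [abs_nonneg (z k).re])
    linarith)
  unfold bondFactorS reProd
  rw [norm_mul, norm_neg, norm_pow, Complex.norm_prod,
    ← Finset.mul_prod_erase Finset.univ (fun j => (1 + |(z j).re|)⁻¹) (Finset.mem_univ ν)]
  have hP : ∏ k ∈ Finset.univ.erase ν, ‖-I * sincI (z k)‖ ≤ ∏ k ∈ Finset.univ.erase ν, 8 * (1 + |(z k).re|)⁻¹ :=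
    Finset.prod_le_prod (fun k _ => norm_nonneg _) fun k _ => by
      rw [norm_mul, norm_neg, Complex.norm_I, one_mul]; exact hs k
  have hQ : ‖sincI (z ν)‖ ^ 2 ≤ 8 * (8 * (1 + |(z ν).re|)⁻¹) := by
    rw [sq]; exact mul_le_mul (hs1 ν) (hs ν) (norm_nonneg _) (by norm_num)
  have hP0 : 0 ≤ ∏ k ∈ Finset.univ.erase ν, 8 * (1 + |(z k).re|)⁻¹ := Finset.prod_nonneg fun k _ => by positivity
  calc (∏ k ∈ Finset.univ.erase ν, ‖-I * sincI (z k)‖) * ‖sincI (z ν)‖ ^ 2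
      ≤ (∏ k ∈ Finset.univ.erase ν, 8 * (1 + |(z k).re|)⁻¹) * (8 * (8 * (1 + |(z ν).re|)⁻¹)) :=
        mul_le_mul hP hQ (by positivity) hP0
    _ = 8 ^ 5 * ((1 + |(z ν).re|)⁻¹ * ∏ k ∈ Finset.univ.erase ν, (1 + |(z k).re|)⁻¹) := by
        rw [Finset.prod_mul_distrib, Finset.prod_const, Finset.card_erase_of_mem (Finset.mem_univ ν),
          Finset.card_univ, Fintype.card_fin]
        ring

/-- **`|b̂_ν(z)| ≤ 8⁵ Π_j(1 + |Re z_j|)⁻¹` on the unit strip.** [cite: FederbushWilliamson1987PhaseCellII, (6.8) p. 1418] -/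
theorem norm_bondFactorE_le {z : Momentum} (hz : ∀ j, |(z j).im| ≤ 1) (ν : Fin 4) :
    ‖bondFactorE ν z‖ ≤ 8 ^ 5 * reProd z := by
  have h := norm_bondFactorS_le (z := fun j => -z j) (fun j => by simpa using hz j) ν
  have e1 : bondFactorS ν (fun j => -z j) = bondFactorE ν z := by simp [bondFactorS, bondFactorE]
  have e2 : reProd (fun j => -z j) = reProd z := by simp [reProd]
  rwa [e1, e2] at h

/-- **Lower bound on the reduced cell**: `|b̂_ν(q)| ≥ (2/π)⁵` for real `q ∈ [−π, π]⁴`. [cite: FederbushWilliamson1987PhaseCellII, §V p. 1418] -/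
theorem norm_bondFactorE_toC_ge {q : Fin 4 → ℝ} (hq : ∀ k, |q k| ≤ Real.pi) (ν : Fin 4) :
    (2 / Real.pi) ^ 5 ≤ ‖bondFactorE ν (toC q)‖ := by
  have hπ : 0 < 2 / Real.pi := by positivity
  have hs : ∀ k, 2 / Real.pi ≤ ‖sincI (-toC q k)‖ := fun k => by
    rw [toC_apply, ← Complex.ofReal_neg]
    exact two_div_pi_le_norm_sincI (by rw [abs_neg]; exact hq k)
  unfold bondFactorE
  rw [norm_mul, norm_neg, norm_pow, Complex.norm_prod]
  have hP : (2 / Real.pi) ^ 3 ≤ ∏ k ∈ Finset.univ.erase ν, ‖-I * sincI (-toC q k)‖ := by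
    have hcard : (Finset.univ.erase ν).card = 3 := by
      rw [Finset.card_erase_of_mem (Finset.mem_univ ν), Finset.card_univ, Fintype.card_fin]
    calc (2 / Real.pi) ^ 3 = ∏ _k ∈ Finset.univ.erase ν, (2 / Real.pi) := by rw [Finset.prod_const, hcard]
      _ ≤ _ := Finset.prod_le_prod (fun k _ => hπ.le) fun k _ => by
          rw [norm_mul, norm_neg, Complex.norm_I, one_mul]; exact hs k
  have hQ : (2 / Real.pi) ^ 2 ≤ ‖sincI (-toC q ν)‖ ^ 2 := pow_le_pow_left₀ hπ.le (hs ν) 2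
  calc (2 / Real.pi) ^ 5 = (2 / Real.pi) ^ 3 * (2 / Real.pi) ^ 2 := by ring
    _ ≤ _ := mul_le_mul hP hQ (by positivity) (Finset.prod_nonneg fun k _ => norm_nonneg _)

end PlaquetteGram

namespace CorrectedMode

open PlaquetteGram
open ModeDecay (toC phase shiftI shiftI_im shiftI_re)
open ModeAnalyticityCorrectedGauge (Xc)
open ModeAnalyticityCellPositivity (delta0 delta0_pos)

/-! ## §3 The gauge-invariant momentum current `Ĵ_ν(z) = z²ĝ_ν − z_ν(z·ĝ)` on the complex tube -/

/-- **`Ĵ_ν` on `ℂ⁴`**: `Ĵ_ν(z) = z² ĝ_ν(z) − z_ν Σ_k z_k ĝ_k(z)` (analytic wherever `ĝ` is; `= (1/2π)² Λ_ν b̂_ν` on the reals).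
[cite: Federbush1986PhaseCellI, (3.4) p. 327, (3.11)–(3.12) p. 328; FederbushWilliamson1987PhaseCellII, Theorem 3.2 p. 1417] -/
def JhatC (s : ℕ) (ν : Fin 4) (z : Momentum) : ℂ := csq z * ghat s ν z - z ν * ∑ k, z k * ghat s k z

/-- **`Ĵ_ν = (1/2π)² Λ_ν b̂_ν` at the real momenta off the lattice hyperplanes** (Landau gauge `p·A′ = 0`, `p²A′_ν = Λ_ν b̂_ν`).
[cite: Federbush1986PhaseCellI, (3.11)–(3.12) p. 328; FederbushWilliamson1987PhaseCellII, (2.1), (2.4) p. 1417] -/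
theorem JhatC_toC (s : ℕ) (ν : Fin 4) {p : Fin 4 → ℝ} (hp : ∀ k (m : ℤ), p k ≠ 2 * Real.pi * m) :
    JhatC s ν (toC p) = ((kR : ℝ) : ℂ) * (Lam ν (toC p) * bondFactor ν p) := by
  have hp0 : ∀ k, p k ≠ 0 := fun k h => hp k 0 (by simpa using h)
  have hpC : ∀ i, toC p i ≠ 0 := fun i => by rw [toC_apply]; exact_mod_cast hp0 i
  have hL : ∑ k, toC p k * Aprime k (toC p) = 0 := sum_coord_mul_Aprime hpC
  have hΛ : Lam ν (toC p) * bondFactor ν p = csq (toC p) * Aprime ν (toC p) := (csq_mul_Aprime_eq hp ν).symm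
  have hcsq : csq (toC p) = ∑ k, (p k : ℂ) ^ 2 := by simp [csq, toC_apply]
  unfold JhatC
  simp_rw [ghat_toC_eq s _ hp]
  rw [hΛ]
  simp only [toC_apply, Fin.sum_univ_four] at hL hcsq ⊢
  rw [hcsq]
  linear_combination (-((kR : ℝ) : ℂ) * (p ν : ℂ)) * hL

/-- `Ĵ_ν` is complex-differentiable on the analyticity tube `𝒟_G(δ₀)` of `ĝ`. [cite: FederbushWilliamson1987PhaseCellII, Theorem 3.2 p. 1417] -/
theorem differentiableOn_JhatC (s : ℕ) (ν : Fin 4) : DifferentiableOn ℂ (JhatC s ν) (DG delta0) := by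
  obtain ⟨c, hA, -⟩ := ghat_pack s
  have hg : ∀ μ, DifferentiableOn ℂ (ghat s μ) (DG delta0) := fun μ => (hA μ).differentiableOn
  have hcsq : Differentiable ℂ (csq : Momentum → ℂ) := by
    unfold csq; exact Differentiable.fun_sum fun j _ => (differentiable_apply j).pow 2
  unfold JhatC
  exact (hcsq.differentiableOn.mul (hg ν)).sub ((differentiable_apply ν).differentiableOn.mul
    (DifferentiableOn.fun_sum fun k _ => (differentiable_apply k).differentiableOn.mul (hg k)))

/-- The width of the working tube: `κ₀ = min(δ₀/2, 1/2)` (inside `𝒟_B(δ₀)`, where II Theorem 3.3's bound holds, and inside the unit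
strip of `sincI`). [cite: FederbushWilliamson1987PhaseCellII, (3.3)–(3.4) p. 1417] -/
def kap0 : ℝ := min (delta0 / 2) (1 / 2)

/-- `0 < κ₀`. [cite: FederbushWilliamson1987PhaseCellII, (3.3) p. 1417] -/
theorem kap0_pos : 0 < kap0 := lt_min (by have := delta0_pos; positivity) (by norm_num)

/-- `κ₀ ≤ δ₀/2`. [cite: FederbushWilliamson1987PhaseCellII, (3.4) p. 1417] -/
theorem kap0_le_half_delta0 : kap0 ≤ delta0 / 2 := min_le_left _ _

/-- `κ₀ ≤ 1/2`. [cite: FederbushWilliamson1987PhaseCellII, (3.4) p. 1417] -/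
theorem kap0_le_half : kap0 ≤ 1 / 2 := min_le_right _ _

/-- The open tube of width `κ`: `T_κ = {z : |Im z_j| < κ ∀j}` (`= DG κ`). [cite: FederbushWilliamson1987PhaseCellII, (3.3) p. 1417] -/
theorem mem_DG_iff {κ : ℝ} {z : Momentum} : z ∈ DG κ ↔ ∀ j, |(z j).im| < κ := Iff.rfl

/-- A point of `T_{κ₀}` lies in `𝒟_B(δ₀)` and in `𝒟_G(δ₀)`. [cite: FederbushWilliamson1987PhaseCellII, (3.3)–(3.4) p. 1417] -/
theorem mem_DB_of_mem_DG_kap0 {z : Momentum} (hz : z ∈ DG kap0) : z ∈ DB delta0 :=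
  fun j => lt_of_lt_of_le (hz j) kap0_le_half_delta0

/-- (idem) [cite: FederbushWilliamson1987PhaseCellII, (3.3)–(3.4) p. 1417] -/
theorem mem_DG_delta0_of_mem_DG_kap0 {z : Momentum} (hz : z ∈ DG kap0) : z ∈ DG delta0 :=
  fun j => lt_of_lt_of_le (hz j) (kap0_le_half_delta0.trans (by linarith [delta0_pos]))

/-- On the tube of width `≤ 1/2`: `|z_ν||z_k| ≤ 2(|z²| + 1)`. [cite: FederbushWilliamson1987PhaseCellII, (3.5) p. 1417] -/
theorem norm_mul_norm_le_two_mul {z : Momentum} (hz : ∀ j, |(z j).im| < 1 / 2) (ν k : Fin 4) :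
    ‖z ν‖ * ‖z k‖ ≤ 2 * (‖csq z‖ + 1) := by
  -- `|z_ν||z_k| ≤ Σ_j |z_j|² = Σ re² + Σ im² ≤ Σ re² + 1`, `|z²| ≥ Re z² = Σ re² − Σ im² ≥ Σ re² − 1`
  have him : ∑ j, (z j).im ^ 2 ≤ 1 := by
    calc ∑ j, (z j).im ^ 2 ≤ ∑ _j : Fin 4, (1 / 2 : ℝ) ^ 2 := Finset.sum_le_sum fun j _ => by
            have := hz j; rw [abs_lt] at this; nlinarith
      _ = 1 := by simp; norm_num
  have hsq : ∀ j, ‖z j‖ ^ 2 = (z j).re ^ 2 + (z j).im ^ 2 := fun j => by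
    rw [Complex.sq_norm, Complex.normSq_apply]; ring
  have hre : (csq z).re = ∑ j, ((z j).re ^ 2 - (z j).im ^ 2) := by
    unfold csq; rw [Complex.re_sum]; exact Finset.sum_congr rfl fun j _ => by rw [sq, Complex.mul_re]; ring
  have hcsq : ∑ j, (z j).re ^ 2 - 1 ≤ ‖csq z‖ := by
    have := Complex.re_le_norm (csq z)
    rw [hre, Finset.sum_sub_distrib] at this
    linarith
  have h2 : ‖z ν‖ * ‖z k‖ ≤ ∑ j, ‖z j‖ ^ 2 := by
    have hνk : ‖z ν‖ * ‖z k‖ ≤ (‖z ν‖ ^ 2 + ‖z k‖ ^ 2) / 2 := by nlinarith [sq_nonneg (‖z ν‖ - ‖z k‖)]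
    rcases eq_or_ne ν k with rfl | hne
    · calc ‖z ν‖ * ‖z ν‖ = ‖z ν‖ ^ 2 := (sq _).symm
        _ ≤ ∑ j, ‖z j‖ ^ 2 := Finset.single_le_sum (f := fun j => ‖z j‖ ^ 2) (fun j _ => sq_nonneg _) (Finset.mem_univ ν)
    · have : ‖z ν‖ ^ 2 + ‖z k‖ ^ 2 ≤ ∑ j, ‖z j‖ ^ 2 :=
        calc ‖z ν‖ ^ 2 + ‖z k‖ ^ 2 = ∑ j ∈ {ν, k}, ‖z j‖ ^ 2 := (Finset.sum_pair (f := fun j => ‖z j‖ ^ 2) hne).symm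
          _ ≤ ∑ j, ‖z j‖ ^ 2 :=
            Finset.sum_le_sum_of_subset_of_nonneg (Finset.subset_univ _) fun j _ _ => sq_nonneg _
      nlinarith [sq_nonneg ‖z ν‖, sq_nonneg ‖z k‖]
  have h3 : ∑ j, ‖z j‖ ^ 2 = ∑ j, (z j).re ^ 2 + ∑ j, (z j).im ^ 2 := by
    rw [← Finset.sum_add_distrib]; exact Finset.sum_congr rfl fun j _ => hsq j
  nlinarith [norm_nonneg (csq z), Finset.sum_nonneg (fun j (_ : j ∈ Finset.univ) => sq_nonneg ((z j).re))]

/-- **The majorant of `Ĵ_ν` on the tube `T_{κ₀}`**: `|Ĵ_ν(z)| ≤ C_J Π_j (1 + |Re z_j|)⁻¹` (from II Theorem 3.3's shape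
`|ĝ| ≤ c Π(|z_j|+1)⁻¹(|z²|+1)⁻¹`). [cite: FederbushWilliamson1987PhaseCellII, Theorem 3.3 (3.5) p. 1417] -/
theorem exists_norm_JhatC_le (s : ℕ) : ∃ C : ℝ, 0 ≤ C ∧ ∀ ν, ∀ z ∈ DG kap0, ‖JhatC s ν z‖ ≤ C * reProd z := by
  obtain ⟨c, -, hB⟩ := ghat_pack s
  have hc0 : 0 ≤ c := by
    have h := hB 0 0 (fun j => by simp [delta0_pos])
    have h1 : (∏ j : Fin 4, (‖(0 : Momentum) j‖ + 1)⁻¹) = 1 := by simp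
    have h2 : (‖csq (0 : Momentum)‖ + 1)⁻¹ = 1 := by simp [csq]
    rw [h1, h2, mul_one, mul_one] at h
    exact (norm_nonneg _).trans h
  refine ⟨9 * c, by positivity, fun ν z hz => ?_⟩
  have hzB : z ∈ DB delta0 := mem_DB_of_mem_DG_kap0 hz
  have hz2 : ∀ j, |(z j).im| < 1 / 2 := fun j => lt_of_lt_of_le (hz j) kap0_le_half
  set P : ℝ := ∏ j, (‖z j‖ + 1)⁻¹ with hP
  have hP0 : 0 ≤ P := Finset.prod_nonneg fun j _ => by positivity
  have hPle : P ≤ reProd z := by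
    refine Finset.prod_le_prod (fun j _ => by positivity) fun j _ => ?_
    rw [add_comm]
    exact inv_anti₀ (by positivity) (by linarith [Complex.abs_re_le_norm (z j)])
  have hQ0 : 0 < ‖csq z‖ + 1 := by positivity
  have hg : ∀ μ, ‖ghat s μ z‖ ≤ c * P * (‖csq z‖ + 1)⁻¹ := fun μ => hB μ z hzB
  -- `|z² ĝ_ν| ≤ cP`
  have hA : ‖csq z * ghat s ν z‖ ≤ c * P := by
    rw [norm_mul]
    calc ‖csq z‖ * ‖ghat s ν z‖ ≤ ‖csq z‖ * (c * P * (‖csq z‖ + 1)⁻¹) :=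
          mul_le_mul_of_nonneg_left (hg ν) (norm_nonneg _)
      _ = c * P * (‖csq z‖ * (‖csq z‖ + 1)⁻¹) := by ring
      _ ≤ c * P * 1 := by
          refine mul_le_mul_of_nonneg_left ?_ (by positivity)
          rw [← div_eq_mul_inv, div_le_one hQ0]; linarith
      _ = c * P := mul_one _
  -- `|z_ν z_k ĝ_k| ≤ 2cP`
  have hBk : ∀ k, ‖z ν * (z k * ghat s k z)‖ ≤ 2 * (c * P) := by
    intro k
    rw [norm_mul, norm_mul, ← mul_assoc]
    calc ‖z ν‖ * ‖z k‖ * ‖ghat s k z‖ ≤ 2 * (‖csq z‖ + 1) * (c * P * (‖csq z‖ + 1)⁻¹) :=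
          mul_le_mul (norm_mul_norm_le_two_mul hz2 ν k) (hg k) (norm_nonneg _) (by positivity)
      _ = 2 * (c * P) * ((‖csq z‖ + 1) * (‖csq z‖ + 1)⁻¹) := by ring
      _ = 2 * (c * P) := by rw [mul_inv_cancel₀ hQ0.ne', mul_one]
  unfold JhatC
  calc ‖csq z * ghat s ν z - z ν * ∑ k, z k * ghat s k z‖
      ≤ ‖csq z * ghat s ν z‖ + ‖z ν * ∑ k, z k * ghat s k z‖ := norm_sub_le _ _
    _ ≤ c * P + ∑ k, ‖z ν * (z k * ghat s k z)‖ := by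
        refine add_le_add hA ?_
        rw [Finset.mul_sum]; exact norm_sum_le _ _
    _ ≤ c * P + ∑ _k : Fin 4, 2 * (c * P) := by
        exact add_le_add le_rfl (Finset.sum_le_sum fun k _ => hBk k)
    _ = 9 * c * P := by simp; ring
    _ ≤ 9 * c * reProd z := mul_le_mul_of_nonneg_left hPle (by positivity)

/-! ## §4 The lattice sums `N_ν = Σ_n Ĵ_ν b̂*_ν(· + 2πn)`, `D_ν = Σ_n b̂_ν b̂*_ν(· + 2πn)`: analytic on the tube `T_{κ₀}` -/

open ModeAnalyticityLatticeSums (b u summable_u b_zero b_of_ne b_nonneg u_nonneg shift_im shift_re)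

/-- The `n`-th term of `N_ν`: `Ĵ_ν(z + 2πn) b̂*_ν(z + 2πn)`. [cite: Federbush1986PhaseCellI, (3.6)–(3.7) p. 327, (3.11) p. 328] -/
def Nterm (s : ℕ) (ν : Fin 4) (n : Fin 4 → ℤ) (z : Momentum) : ℂ := JhatC s ν (shift z n) * bondFactorS ν (shift z n)

/-- The `n`-th term of `D_ν`: `b̂_ν(z + 2πn) b̂*_ν(z + 2πn)` (`= |b̂_ν(p + 2πn)|²` on the reals). [cite: FederbushWilliamson1987PhaseCellII, (1.4) p. 1416] -/
def Dterm (ν : Fin 4) (n : Fin 4 → ℤ) (z : Momentum) : ℂ := bondFactorE ν (shift z n) * bondFactorS ν (shift z n)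

/-- **`N_ν(z) = Σ_{n∈ℤ⁴} Ĵ_ν(z + 2πn) b̂*_ν(z + 2πn)`** (numerator of the analytic representative of `Λ_ν`).
[cite: Federbush1986PhaseCellI, (3.6)–(3.7) p. 327, (3.11) p. 328; FederbushWilliamson1987PhaseCellII, (1.4) p. 1416] -/
def Nsum (s : ℕ) (ν : Fin 4) (z : Momentum) : ℂ := ∑' n : Fin 4 → ℤ, Nterm s ν n z

/-- **`D_ν(z) = Σ_{n∈ℤ⁴} b̂_ν(z + 2πn) b̂*_ν(z + 2πn)`** (denominator; `= Σ_n |b̂_ν(p + 2πn)|² > 0` on the reals).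
[cite: FederbushWilliamson1987PhaseCellII, (1.4) p. 1416, §V p. 1418] -/
def Dsum (ν : Fin 4) (z : Momentum) : ℂ := ∑' n : Fin 4 → ℤ, Dterm ν n z

/-- `shift` does not change imaginary parts: the tube is shift-invariant. [cite: FederbushWilliamson1987PhaseCellII, (3.1) p. 1417] -/
theorem shift_mem_DG {κ : ℝ} {z : Momentum} (hz : z ∈ DG κ) (n : Fin 4 → ℤ) : shift z n ∈ DG κ :=
  fun j => by rw [shift_im]; exact hz j

/-- `z ↦ z + 2πn` is entire. [cite: FederbushWilliamson1987PhaseCellII, (3.1) p. 1417] -/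
theorem differentiable_shift (n : Fin 4 → ℤ) : Differentiable ℂ fun z : Momentum => shift z n :=
  differentiable_pi.2 fun j => ((differentiable_apply j).add_const _ : Differentiable ℂ fun z : Momentum => z j + _)

/-- **`N_ν` is `2πℤ⁴`-periodic** (reindexing). [cite: FederbushWilliamson1987PhaseCellII, (3.1) p. 1417] -/
theorem Nsum_shift (s : ℕ) (ν : Fin 4) (z : Momentum) (m : Fin 4 → ℤ) : Nsum s ν (shift z m) = Nsum s ν z := by
  unfold Nsum Nterm
  simp_rw [shift_shift']
  exact (Equiv.addLeft m).tsum_eq fun n => JhatC s ν (shift z n) * bondFactorS ν (shift z n)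

/-- **`D_ν` is `2πℤ⁴`-periodic.** [cite: FederbushWilliamson1987PhaseCellII, (3.1) p. 1417] -/
theorem Dsum_shift (ν : Fin 4) (z : Momentum) (m : Fin 4 → ℤ) : Dsum ν (shift z m) = Dsum ν z := by
  unfold Dsum Dterm
  simp_rw [shift_shift']
  exact (Equiv.addLeft m).tsum_eq fun n => bondFactorE ν (shift z n) * bondFactorS ν (shift z n)

/-- The open box-tube `{|Re z_j| < R, |Im z_j| < κ}`. [cite: FederbushWilliamson1987PhaseCellII, (3.2)–(3.3) p. 1417] -/
def boxTube (R κ : ℝ) : Set Momentum := {z | ∀ j, |(z j).re| < R ∧ |(z j).im| < κ}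

/-- `boxTube` is open. [cite: FederbushWilliamson1987PhaseCellII, (3.2)–(3.3) p. 1417] -/
theorem isOpen_boxTube (R κ : ℝ) : IsOpen (boxTube R κ) := by
  have : boxTube R κ = ⋂ j : Fin 4, ({z : Momentum | |(z j).re| < R} ∩ {z | |(z j).im| < κ}) := by
    ext z; simp [boxTube]
  rw [this]
  refine isOpen_iInter_of_finite fun j => IsOpen.inter ?_ ?_
  · exact isOpen_lt (continuous_abs.comp (Complex.continuous_re.comp (continuous_apply j))) continuous_const
  · exact isOpen_lt (continuous_abs.comp (Complex.continuous_im.comp (continuous_apply j))) continuous_const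

/-- `boxTube R κ ⊆ T_κ`. [cite: FederbushWilliamson1987PhaseCellII, (3.3) p. 1417] -/
theorem boxTube_subset_DG (R κ : ℝ) : boxTube R κ ⊆ DG κ := fun _ hz j => (hz j).2

/-- **The lattice weight bound**: for `1 ≤ R`, `|x| ≤ R`, `m ∈ ℤ`: `(1 + |x + 2πm|)⁻² ≤ 25R² b(m)` (p04's summable weights `b`).
[cite: FederbushWilliamson1987PhaseCellII, (6.8) p. 1418] -/
theorem inv_sq_le_b {R x : ℝ} (hR : 1 ≤ R) (hx : |x| ≤ R) (m : ℤ) :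
    ((1 + |x + 2 * Real.pi * m|)⁻¹) ^ 2 ≤ 25 * R ^ 2 * b m := by
  have hπ : 3 < Real.pi := Real.pi_gt_three
  by_cases hm : m = 0
  · rw [hm, b_zero]
    have : (1 + |x + 2 * Real.pi * ((0 : ℤ) : ℝ)|)⁻¹ ≤ 1 := inv_le_one_of_one_le₀ (by linarith [abs_nonneg (x + 2 * Real.pi * ((0 : ℤ) : ℝ))])
    have h0 : 0 ≤ (1 + |x + 2 * Real.pi * ((0 : ℤ) : ℝ)|)⁻¹ := by positivity
    nlinarith
  rw [b_of_ne hm]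
  -- `R(1 + |x + 2πm|) ≥ |m|`
  have hm1 : (1 : ℝ) ≤ |(m : ℝ)| := by
    rw [← Int.cast_abs]; exact_mod_cast Int.one_le_abs hm
  have key : |(m : ℝ)| ≤ R * (1 + |x + 2 * Real.pi * m|) := by
    by_cases hmR : |(m : ℝ)| ≤ R
    · nlinarith [abs_nonneg (x + 2 * Real.pi * m)]
    · rw [not_le] at hmR
      have h1 : 2 * Real.pi * |(m : ℝ)| - R ≤ |x + 2 * Real.pi * m| := by
        have := abs_sub_abs_le_abs_sub (2 * Real.pi * m) (-x)
        rw [abs_mul, abs_of_pos (by positivity : (0:ℝ) < 2 * Real.pi), abs_neg, sub_neg_eq_add, add_comm] at this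
        linarith
      have h2 : (1 : ℝ) * (1 + |x + 2 * Real.pi * m|) ≤ R * (1 + |x + 2 * Real.pi * m|) :=
        mul_le_mul_of_nonneg_right hR (by positivity)
      have h3 : 3 * |(m : ℝ)| ≤ Real.pi * |(m : ℝ)| := mul_le_mul_of_nonneg_right hπ.le (abs_nonneg _)
      linarith
  have hpos : 0 < 1 + |x + 2 * Real.pi * m| := by positivity
  have hm0 : 0 < |(m : ℝ)| := by linarith
  calc ((1 + |x + 2 * Real.pi * m|)⁻¹) ^ 2 ≤ (R / |(m : ℝ)|) ^ 2 := by
        refine pow_le_pow_left₀ (by positivity) ?_ 2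
        rw [inv_le_iff_one_le_mul₀ hpos, div_mul_eq_mul_div, one_le_div hm0]
        exact key
    _ = 25 * R ^ 2 * (1 / (25 * (m : ℝ) ^ 2)) := by
        rw [div_pow, sq_abs]; field_simp
        
/-- `reProd(z + 2πn)² ≤ (25R²)⁴ u(n)` on the box `|Re z_j| ≤ R` (`1 ≤ R`). [cite: FederbushWilliamson1987PhaseCellII, (6.8) p. 1418] -/
theorem reProd_shift_sq_le {R : ℝ} (hR : 1 ≤ R) {z : Momentum} (hz : ∀ j, |(z j).re| ≤ R) (n : Fin 4 → ℤ) :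
    reProd (shift z n) ^ 2 ≤ (25 * R ^ 2) ^ 4 * u n := by
  unfold reProd u
  rw [← Finset.prod_pow, show (25 * R ^ 2) ^ 4 = ∏ _j : Fin 4, (25 * R ^ 2) by simp, ← Finset.prod_mul_distrib]
  refine Finset.prod_le_prod (fun j _ => by positivity) fun j _ => ?_
  rw [shift_re]
  exact inv_sq_le_b hR (hz j) (n j)

/-- **Termwise bound for `N_ν` on the box-tube** `|Re z_j| < R`, `|Im z_j| < κ₀`: `‖Ĵ_ν b̂*_ν(z + 2πn)‖ ≤ C_J 8⁵ (25R²)⁴ u(n)`.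
[cite: FederbushWilliamson1987PhaseCellII, (6.8) p. 1418] -/
theorem norm_Nterm_le (s : ℕ) {C : ℝ} (hC : 0 ≤ C ∧ ∀ ν, ∀ z ∈ DG kap0, ‖JhatC s ν z‖ ≤ C * reProd z) {R : ℝ} (hR : 1 ≤ R)
    (ν : Fin 4) (n : Fin 4 → ℤ) {z : Momentum} (hz : z ∈ boxTube R kap0) :
    ‖Nterm s ν n z‖ ≤ C * 8 ^ 5 * (25 * R ^ 2) ^ 4 * u n := by
  have hzs : shift z n ∈ DG kap0 := shift_mem_DG (boxTube_subset_DG R kap0 hz) n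
  have hzs1 : ∀ j, |(shift z n j).im| ≤ 1 := fun j => ((hzs j).le.trans kap0_le_half).trans (by norm_num)
  have h1 := hC.2 ν _ hzs
  have h2 := norm_bondFactorS_le hzs1 ν
  have h3 := reProd_shift_sq_le hR (fun j => (hz j).1.le) n
  unfold Nterm
  rw [norm_mul]
  calc ‖JhatC s ν (shift z n)‖ * ‖bondFactorS ν (shift z n)‖ ≤ (C * reProd (shift z n)) * (8 ^ 5 * reProd (shift z n)) :=
        mul_le_mul h1 h2 (norm_nonneg _) (mul_nonneg hC.1 (reProd_nonneg _))
    _ = C * 8 ^ 5 * reProd (shift z n) ^ 2 := by ring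
    _ ≤ C * 8 ^ 5 * ((25 * R ^ 2) ^ 4 * u n) := mul_le_mul_of_nonneg_left h3 (by have := hC.1; positivity)
    _ = _ := by ring

/-- **Termwise bound for `D_ν` on the box-tube.** [cite: FederbushWilliamson1987PhaseCellII, (6.8) p. 1418] -/
theorem norm_Dterm_le {R : ℝ} (hR : 1 ≤ R) (ν : Fin 4) (n : Fin 4 → ℤ) {z : Momentum} (hz : z ∈ boxTube R kap0) :
    ‖Dterm ν n z‖ ≤ (8 ^ 5) ^ 2 * (25 * R ^ 2) ^ 4 * u n := by
  have hzs : shift z n ∈ DG kap0 := shift_mem_DG (boxTube_subset_DG R kap0 hz) n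
  have hzs1 : ∀ j, |(shift z n j).im| ≤ 1 := fun j => ((hzs j).le.trans kap0_le_half).trans (by norm_num)
  have h1 := norm_bondFactorE_le hzs1 ν
  have h2 := norm_bondFactorS_le hzs1 ν
  have h3 := reProd_shift_sq_le hR (fun j => (hz j).1.le) n
  unfold Dterm
  rw [norm_mul]
  calc ‖bondFactorE ν (shift z n)‖ * ‖bondFactorS ν (shift z n)‖
      ≤ (8 ^ 5 * reProd (shift z n)) * (8 ^ 5 * reProd (shift z n)) :=
        mul_le_mul h1 h2 (norm_nonneg _) (by have := reProd_nonneg (shift z n); positivity)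
    _ = (8 ^ 5) ^ 2 * reProd (shift z n) ^ 2 := by ring
    _ ≤ (8 ^ 5) ^ 2 * ((25 * R ^ 2) ^ 4 * u n) := mul_le_mul_of_nonneg_left h3 (by positivity)
    _ = _ := by ring

/-- The terms of `N_ν` are complex-differentiable on `T_{κ₀}`. [cite: FederbushWilliamson1987PhaseCellII, Theorem 3.2 p. 1417] -/
theorem differentiableOn_Nterm (s : ℕ) (ν : Fin 4) (n : Fin 4 → ℤ) : DifferentiableOn ℂ (Nterm s ν n) (DG kap0) := by
  unfold Nterm
  refine DifferentiableOn.mul ?_ ((differentiable_bondFactorS ν).comp (differentiable_shift n)).differentiableOn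
  exact (differentiableOn_JhatC s ν).comp (differentiable_shift n).differentiableOn
    fun z hz => mem_DG_delta0_of_mem_DG_kap0 (shift_mem_DG hz n)

/-- The terms of `D_ν` are entire. [cite: FederbushWilliamson1987PhaseCellII, §III p. 1417] -/
theorem differentiable_Dterm (ν : Fin 4) (n : Fin 4 → ℤ) : Differentiable ℂ (Dterm ν n) := by
  unfold Dterm
  exact ((differentiable_bondFactorE ν).comp (differentiable_shift n)).mul
    ((differentiable_bondFactorS ν).comp (differentiable_shift n))

/-- **`N_ν` is analytic on each box-tube `|Re z_j| < R`, `|Im z_j| < κ₀`** (normal convergence + the tree's several-variable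
Weierstrass theorem `Literature.Analysis.Complex.SCV.analyticOnNhd_tsum_of_summable_norm`). [cite: FederbushWilliamson1987PhaseCellII, (6.1), (6.8) p. 1418] -/
theorem analyticOnNhd_Nsum_boxTube (s : ℕ) (ν : Fin 4) {R : ℝ} (hR : 1 ≤ R) : AnalyticOnNhd ℂ (Nsum s ν) (boxTube R kap0) := by
  obtain ⟨C, hC⟩ := exists_norm_JhatC_le s
  exact Literature.Analysis.Complex.SCV.analyticOnNhd_tsum_of_summable_norm (F := ℂ)
    (f := fun (n : Fin 4 → ℤ) (z : Momentum) => Nterm s ν n z) (isOpen_boxTube R kap0)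
    (fun n => (differentiableOn_Nterm s ν n).mono (boxTube_subset_DG R kap0))
    (summable_u.mul_left (C * 8 ^ 5 * (25 * R ^ 2) ^ 4)) (fun n _ hz => norm_Nterm_le s hC hR ν n hz)

/-- **`D_ν` is analytic on each box-tube.** [cite: FederbushWilliamson1987PhaseCellII, (6.1), (6.8) p. 1418] -/
theorem analyticOnNhd_Dsum_boxTube (ν : Fin 4) {R : ℝ} (hR : 1 ≤ R) : AnalyticOnNhd ℂ (Dsum ν) (boxTube R kap0) :=
  Literature.Analysis.Complex.SCV.analyticOnNhd_tsum_of_summable_norm (F := ℂ)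
    (f := fun (n : Fin 4 → ℤ) (z : Momentum) => Dterm ν n z) (isOpen_boxTube R kap0)
    (fun n => (differentiable_Dterm ν n).differentiableOn)
    (summable_u.mul_left ((8 ^ 5) ^ 2 * (25 * R ^ 2) ^ 4)) (fun n _ hz => norm_Dterm_le hR ν n hz)

/-- Every point of the tube lies in some box-tube with `R ≥ 1`. [cite: FederbushWilliamson1987PhaseCellII, (3.3) p. 1417] -/
theorem exists_mem_boxTube {z : Momentum} (hz : z ∈ DG kap0) : ∃ R : ℝ, 1 ≤ R ∧ z ∈ boxTube R kap0 := by
  refine ⟨1 + ∑ j, |(z j).re|, by have := Finset.sum_nonneg (fun j (_ : j ∈ Finset.univ) => abs_nonneg (z j).re); linarith,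
    fun j => ⟨?_, hz j⟩⟩
  have := Finset.single_le_sum (f := fun j => |(z j).re|) (fun j _ => abs_nonneg _) (Finset.mem_univ j)
  linarith

/-- **`N_ν` is analytic on the whole tube `T_{κ₀}`.** [cite: FederbushWilliamson1987PhaseCellII, Theorem 3.2 p. 1417, (6.8) p. 1418] -/
theorem analyticOnNhd_Nsum (s : ℕ) (ν : Fin 4) : AnalyticOnNhd ℂ (Nsum s ν) (DG kap0) := fun z hz => by
  obtain ⟨R, hR, hzR⟩ := exists_mem_boxTube hz
  exact analyticOnNhd_Nsum_boxTube s ν hR z hzR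

/-- **`D_ν` is analytic on the whole tube `T_{κ₀}`.** [cite: FederbushWilliamson1987PhaseCellII, §III p. 1417, (6.8) p. 1418] -/
theorem analyticOnNhd_Dsum (ν : Fin 4) : AnalyticOnNhd ℂ (Dsum ν) (DG kap0) := fun z hz => by
  obtain ⟨R, hR, hzR⟩ := exists_mem_boxTube hz
  exact analyticOnNhd_Dsum_boxTube ν hR z hzR

/-- **Uniform bound for `N_ν` on a box-tube.** [cite: FederbushWilliamson1987PhaseCellII, (6.8) p. 1418] -/
theorem exists_norm_Nsum_le (s : ℕ) {R : ℝ} (hR : 1 ≤ R) :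
    ∃ C : ℝ, 0 ≤ C ∧ ∀ ν, ∀ z ∈ boxTube R kap0, ‖Nsum s ν z‖ ≤ C := by
  obtain ⟨C, hC⟩ := exists_norm_JhatC_le s
  refine ⟨C * 8 ^ 5 * (25 * R ^ 2) ^ 4 * ∑' n, u n, by
    have := hC.1; have : (0 : ℝ) ≤ ∑' n, u n := tsum_nonneg u_nonneg; positivity, fun ν z hz => ?_⟩
  have hs : Summable fun n => C * 8 ^ 5 * (25 * R ^ 2) ^ 4 * u n := summable_u.mul_left _
  unfold Nsum
  calc ‖∑' n, Nterm s ν n z‖ ≤ ∑' n, ‖Nterm s ν n z‖ := norm_tsum_le_tsum_norm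
          (Summable.of_nonneg_of_le (fun n => norm_nonneg _) (fun n => norm_Nterm_le s hC hR ν n hz) hs)
    _ ≤ ∑' n, C * 8 ^ 5 * (25 * R ^ 2) ^ 4 * u n :=
        (Summable.of_nonneg_of_le (fun n => norm_nonneg _) (fun n => norm_Nterm_le s hC hR ν n hz) hs).tsum_le_tsum
          (fun n => norm_Nterm_le s hC hR ν n hz) hs
    _ = _ := tsum_mul_left

/-! ### Real values: `D_ν(p) = Σ_n |b̂_ν(p + 2πn)|² ≥ (2/π)^{10}`, `N_ν(p) = (1/2π)² Λ_ν(p) D_ν(p)` -/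

/-- The real form of `D_ν`: `Σ_n |b̂_ν(p + 2πn)|²`. [cite: FederbushWilliamson1987PhaseCellII, (1.4) p. 1416] -/
def DsumR (ν : Fin 4) (p : Fin 4 → ℝ) : ℝ := ∑' n : Fin 4 → ℤ, ‖bondFactorE ν (toC (shiftR p n))‖ ^ 2

/-- `Dterm ν n (p) = |b̂_ν(p + 2πn)|²` at a real momentum. [cite: FederbushWilliamson1987PhaseCellII, (1.4)–(1.5) p. 1416] -/
theorem Dterm_toC (ν : Fin 4) (n : Fin 4 → ℤ) (p : Fin 4 → ℝ) :
    Dterm ν n (toC p) = ((‖bondFactorE ν (toC (shiftR p n))‖ ^ 2 : ℝ) : ℂ) := by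
  rw [Dterm, ← toC_shiftR, bondFactorE_mul_bondFactorS_toC]

/-- The real series of `D_ν` is summable. [cite: FederbushWilliamson1987PhaseCellII, (6.8) p. 1418] -/
theorem summable_DsumR (ν : Fin 4) (p : Fin 4 → ℝ) : Summable fun n : Fin 4 → ℤ => ‖bondFactorE ν (toC (shiftR p n))‖ ^ 2 := by
  obtain ⟨R, hR, hpR⟩ := exists_mem_boxTube (toC_mem_DG kap0_pos p)
  refine Summable.of_nonneg_of_le (fun n => sq_nonneg _) (fun n => ?_) (summable_u.mul_left ((8 ^ 5) ^ 2 * (25 * R ^ 2) ^ 4))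
  have h := norm_Dterm_le hR ν n hpR
  rwa [Dterm_toC, Complex.norm_real, Real.norm_of_nonneg (sq_nonneg _)] at h

/-- **`D_ν(p) = Σ_n |b̂_ν(p + 2πn)|²` at real momenta** (a real number). [cite: FederbushWilliamson1987PhaseCellII, (1.4) p. 1416] -/
theorem Dsum_toC (ν : Fin 4) (p : Fin 4 → ℝ) : Dsum ν (toC p) = ((DsumR ν p : ℝ) : ℂ) := by
  unfold Dsum DsumR
  rw [Complex.ofReal_tsum]
  exact tsum_congr fun n => Dterm_toC ν n p

/-- **Positivity on the reals: `D_ν(p) ≥ (2/π)^{10}`** — the term with `p + 2πn₀ ∈ [−π, π]⁴` alone. [cite: FederbushWilliamson1987PhaseCellII, §V p. 1418] -/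
theorem DsumR_ge (ν : Fin 4) (p : Fin 4 → ℝ) : ((2 / Real.pi) ^ 5) ^ 2 ≤ DsumR ν p := by
  set n₀ : Fin 4 → ℤ := fun j => -round (p j / (2 * Real.pi)) with hn₀
  have hq : ∀ k, |shiftR p n₀ k| ≤ Real.pi := by
    intro k
    have h2π : 0 < 2 * Real.pi := Real.two_pi_pos
    have h := abs_sub_round (p k / (2 * Real.pi))
    have : shiftR p n₀ k = 2 * Real.pi * (p k / (2 * Real.pi) - round (p k / (2 * Real.pi))) := by
      simp only [shiftR, hn₀, Int.cast_neg]; field_simp; ring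
    rw [this, abs_mul, abs_of_pos h2π]
    nlinarith
  have h1 := norm_bondFactorE_toC_ge hq ν
  calc ((2 / Real.pi) ^ 5) ^ 2 ≤ ‖bondFactorE ν (toC (shiftR p n₀))‖ ^ 2 := pow_le_pow_left₀ (by positivity) h1 2
    _ ≤ DsumR ν p := (summable_DsumR ν p).le_tsum n₀ fun n _ => sq_nonneg _

/-- `‖D_ν(p)‖ ≥ (2/π)^{10}` at real momenta. [cite: FederbushWilliamson1987PhaseCellII, §V p. 1418] -/
theorem norm_Dsum_toC_ge (ν : Fin 4) (p : Fin 4 → ℝ) : ((2 / Real.pi) ^ 5) ^ 2 ≤ ‖Dsum ν (toC p)‖ := by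
  rw [Dsum_toC, Complex.norm_real, Real.norm_of_nonneg (le_trans (by positivity) (DsumR_ge ν p))]
  exact DsumR_ge ν p

/-- `D_ν(p) ≠ 0` at real momenta. [cite: FederbushWilliamson1987PhaseCellII, §V p. 1418] -/
theorem Dsum_toC_ne_zero (ν : Fin 4) (p : Fin 4 → ℝ) : Dsum ν (toC p) ≠ 0 := fun h => by
  have := norm_Dsum_toC_ge ν p
  rw [h, norm_zero] at this
  exact absurd this (not_le.mpr (by positivity))

/-- `Nterm = (1/2π)² Λ_ν(p) · Dterm` at a real momentum off the lattice hyperplanes (`Λ_ν` periodic, `Ĵ_ν = (1/2π)²Λ_νb̂_ν`).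
[cite: Federbush1986PhaseCellI, (3.11) p. 328; FederbushWilliamson1987PhaseCellII, (2.1), (3.1) p. 1417] -/
theorem Nterm_toC (s : ℕ) (ν : Fin 4) (n : Fin 4 → ℤ) {p : Fin 4 → ℝ} (hp : ∀ k (m : ℤ), p k ≠ 2 * Real.pi * m) :
    Nterm s ν n (toC p) = ((kR : ℝ) : ℂ) * Lam ν (toC p) * Dterm ν n (toC p) := by
  have hpn : ∀ k (m : ℤ), shiftR p n k ≠ 2 * Real.pi * m := fun k m => by
    intro h
    apply hp k (m - n k)
    simp only [shiftR] at h
    push_cast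
    linarith
  have hpn0 : ∀ k, shiftR p n k ≠ 0 := fun k => shiftR_ne_zero (hp k) n
  rw [Nterm, Dterm, ← toC_shiftR, JhatC_toC s ν hpn, ← bondFactorE_toC hpn0, toC_shiftR, Lam_shift]
  ring

/-- **`N_ν(p) = (1/2π)² Λ_ν(p) D_ν(p)` at every real momentum off the lattice hyperplanes.** [cite: Federbush1986PhaseCellI, (3.11) p. 328; FederbushWilliamson1987PhaseCellII, (2.1) p. 1417] -/
theorem Nsum_toC (s : ℕ) (ν : Fin 4) {p : Fin 4 → ℝ} (hp : ∀ k (m : ℤ), p k ≠ 2 * Real.pi * m) :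
    Nsum s ν (toC p) = ((kR : ℝ) : ℂ) * Lam ν (toC p) * Dsum ν (toC p) := by
  unfold Nsum Dsum
  rw [← tsum_mul_left]
  exact tsum_congr fun n => Nterm_toC s ν n hp

/-! ## §5 `D_ν` stays away from zero on a thin tube over a box containing the closed momentum cell -/

/-- `(p, τ) ↦ p + iτ` is continuous. [cite: FederbushWilliamson1987PhaseCellII, §III p. 1417] -/
theorem continuous_shiftI_uncurry : Continuous fun pt : (Fin 4 → ℝ) × (Fin 4 → ℝ) => shiftI pt.1 pt.2 := by
  refine continuous_pi fun j => ?_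
  simp only [shiftI]
  fun_prop

/-- `p + i0 = p` (pointwise form). [cite: FederbushWilliamson1987PhaseCellII, §III p. 1417] -/
theorem shiftI_zero' (p : Fin 4 → ℝ) : shiftI p (fun _ => 0) = toC p := by
  funext j; simp [shiftI, toC]

/-- `dist(p + iτ, p) ≤ max_j |τ_j|`: `dist (shiftI p τ) (toC p) < r` when all `|τ_j| < r`. [cite: FederbushWilliamson1987PhaseCellII, §III p. 1417] -/
theorem dist_shiftI_toC_lt {p τ : Fin 4 → ℝ} {r : ℝ} (hr : 0 < r) (hτ : ∀ j, |τ j| < r) : dist (shiftI p τ) (toC p) < r := by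
  rw [dist_pi_lt_iff hr]
  intro j
  rw [dist_eq_norm]
  simp only [shiftI, toC_apply, add_sub_cancel_left, norm_mul, Complex.norm_real, Complex.norm_I, mul_one, Real.norm_eq_abs]
  exact hτ j

/-- **`D_ν` is bounded away from zero on a thin tube over the box `|p_j| ≤ 9`**: there is `κ₁ ∈ (0, κ₀)` with
`‖D_ν(p + iτ)‖ ≥ ½(2/π)^{10}` whenever `|p_j| ≤ 9`, `|τ_j| ≤ κ₁` (uniform continuity of `D_ν` on a compact piece of the tube
+ the real lower bound). [cite: FederbushWilliamson1987PhaseCellII, §V p. 1418, (3.3) p. 1417] -/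
theorem exists_norm_Dsum_shiftI_ge (ν : Fin 4) : ∃ κ₁ : ℝ, 0 < κ₁ ∧ κ₁ < kap0 ∧
    ∀ p : Fin 4 → ℝ, (∀ j, |p j| ≤ 9) → ∀ τ : Fin 4 → ℝ, (∀ j, |τ j| ≤ κ₁) →
      ((2 / Real.pi) ^ 5) ^ 2 / 2 ≤ ‖Dsum ν (shiftI p τ)‖ := by
  set cD : ℝ := ((2 / Real.pi) ^ 5) ^ 2 with hcD
  have hcD0 : 0 < cD := by positivity
  -- the compact piece of the tube
  set B9 : Set (Fin 4 → ℝ) := Icc (fun _ => (-9 : ℝ)) (fun _ => 9) with hB9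
  set Bk : Set (Fin 4 → ℝ) := Icc (fun _ => -(kap0 / 2)) (fun _ => kap0 / 2) with hBk
  set K : Set Momentum := (fun pt : (Fin 4 → ℝ) × (Fin 4 → ℝ) => shiftI pt.1 pt.2) '' (B9 ×ˢ Bk) with hK
  have hKc : IsCompact K := (isCompact_Icc.prod isCompact_Icc).image continuous_shiftI_uncurry
  have hKsub : K ⊆ DG kap0 := by
    rintro z ⟨⟨p, τ⟩, ⟨-, hτ⟩, rfl⟩ j
    simp only [shiftI_im]
    have h1 := hτ.1 j; have h2 := hτ.2 j
    simp only at h1 h2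
    rw [abs_lt]; constructor <;> linarith [kap0_pos]
  have hcont : ContinuousOn (Dsum ν) K := (analyticOnNhd_Dsum ν).continuousOn.mono hKsub
  have huc := hKc.uniformContinuousOn_of_continuous hcont
  rw [Metric.uniformContinuousOn_iff] at huc
  obtain ⟨δ, hδ, hδε⟩ := huc (cD / 2) (by positivity)
  refine ⟨min (δ / 2) (kap0 / 2), lt_min (by positivity) (by linarith [kap0_pos]),
    lt_of_le_of_lt (min_le_right _ _) (by linarith [kap0_pos]), fun p hp τ hτ => ?_⟩
  have hpB : p ∈ B9 := ⟨fun j => (abs_le.mp (hp j)).1, fun j => (abs_le.mp (hp j)).2⟩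
  have hτB : τ ∈ Bk := ⟨fun j => (abs_le.mp ((hτ j).trans (min_le_right _ _))).1,
    fun j => (abs_le.mp ((hτ j).trans (min_le_right _ _))).2⟩
  have h0B : (fun _ : Fin 4 => (0 : ℝ)) ∈ Bk := ⟨fun j => by simp; linarith [kap0_pos], fun j => by simp; linarith [kap0_pos]⟩
  have hz1 : shiftI p τ ∈ K := ⟨(p, τ), ⟨hpB, hτB⟩, rfl⟩
  have hz0 : toC p ∈ K := ⟨(p, fun _ => 0), ⟨hpB, h0B⟩, shiftI_zero' p⟩
  have hd : dist (shiftI p τ) (toC p) < δ :=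
    dist_shiftI_toC_lt hδ fun j => lt_of_le_of_lt ((hτ j).trans (min_le_left _ _)) (by linarith)
  have hclose := hδε _ hz1 _ hz0 hd
  rw [dist_eq_norm] at hclose
  have hreal := norm_Dsum_toC_ge ν p
  have := norm_sub_norm_le (Dsum ν (toC p)) (Dsum ν (shiftI p τ))
  rw [← norm_neg, neg_sub] at hclose
  linarith

/-! ## §6 The analytic representative `Λ̃_ν = N_ν/((1/2π)² D_ν)` of the multiplier on a tube over the cell -/

/-- **`Λ̃_ν(z) := N_ν(z)/((1/2π)² D_ν(z))`** — analytic on a thin tube over the cell, bounded, `2πℤ⁴`-periodic, and EQUAL TO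
`Λ_ν` at the real momenta off the lattice hyperplanes. [cite: Federbush1986PhaseCellI, (3.11) p. 328; FederbushWilliamson1987PhaseCellII, (2.1) p. 1417, §III p. 1417] -/
def LamT (s : ℕ) (ν : Fin 4) (z : Momentum) : ℂ := Nsum s ν z / (((kR : ℝ) : ℂ) * Dsum ν z)

/-- `(1/2π)² ≠ 0`. [folklore] -/
private theorem kR_ne_zero : ((kR : ℝ) : ℂ) ≠ 0 := by
  rw [Ne, Complex.ofReal_eq_zero]; unfold kR; positivity

/-- **`Λ̃_ν = Λ_ν` at the real momenta off the lattice hyperplanes.** [cite: Federbush1986PhaseCellI, (3.11) p. 328; FederbushWilliamson1987PhaseCellII, (2.1) p. 1417] -/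
theorem LamT_toC (s : ℕ) (ν : Fin 4) {p : Fin 4 → ℝ} (hp : ∀ k (m : ℤ), p k ≠ 2 * Real.pi * m) :
    LamT s ν (toC p) = Lam ν (toC p) := by
  have hk := kR_ne_zero
  have hD := Dsum_toC_ne_zero ν p
  rw [LamT, Nsum_toC s ν hp]
  field_simp

/-- **`Λ̃_ν` is `2πℤ⁴`-periodic.** [cite: FederbushWilliamson1987PhaseCellII, (3.1) p. 1417] -/
theorem LamT_shift (s : ℕ) (ν : Fin 4) (z : Momentum) (m : Fin 4 → ℤ) : LamT s ν (shift z m) = LamT s ν z := by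
  rw [LamT, LamT, Nsum_shift, Dsum_shift]

/-- `z = Re z + i Im z`. [cite: FederbushWilliamson1987PhaseCellII, §III p. 1417] -/
theorem shiftI_re_im (z : Momentum) : shiftI (fun j => (z j).re) (fun j => (z j).im) = z := by
  funext j; simp only [shiftI]; exact Complex.re_add_im (z j)

/-- **The tube over the cell where `Λ̃_ν` lives**: with `κ₁` from `exists_norm_Dsum_shiftI_ge`, on
`V = {|Re z_j| < 9, |Im z_j| < κ₁}` the function `Λ̃_ν` is complex-differentiable and bounded.
[cite: FederbushWilliamson1987PhaseCellII, §III p. 1417, (6.8) p. 1418; Federbush1986PhaseCellI, (3.11) p. 328] -/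
theorem exists_LamT_analytic_bounded (s : ℕ) (ν : Fin 4) : ∃ κ₁ C : ℝ, 0 < κ₁ ∧ κ₁ < kap0 ∧ 0 ≤ C ∧
    DifferentiableOn ℂ (LamT s ν) (boxTube 9 κ₁) ∧
    (∀ z ∈ boxTube 9 κ₁, ‖LamT s ν z‖ ≤ C) ∧
    (∀ z ∈ boxTube 9 κ₁, ((2 / Real.pi) ^ 5) ^ 2 / 2 ≤ ‖Dsum ν z‖) := by
  obtain ⟨κ₁, hκ₁, hκ₁0, hD⟩ := exists_norm_Dsum_shiftI_ge ν
  obtain ⟨CN, hCN0, hCN⟩ := exists_norm_Nsum_le s (R := 9) (by norm_num)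
  have hsub : boxTube 9 κ₁ ⊆ boxTube 9 kap0 := fun z hz j => ⟨(hz j).1, lt_trans (hz j).2 hκ₁0⟩
  have hDz : ∀ z ∈ boxTube 9 κ₁, ((2 / Real.pi) ^ 5) ^ 2 / 2 ≤ ‖Dsum ν z‖ := by
    intro z hz
    have h := hD (fun j => (z j).re) (fun j => (hz j).1.le) (fun j => (z j).im) (fun j => (hz j).2.le)
    rwa [shiftI_re_im] at h
  have hc0 : 0 < ((2 / Real.pi) ^ 5) ^ 2 / 2 := by positivity
  have hDne : ∀ z ∈ boxTube 9 κ₁, ((kR : ℝ) : ℂ) * Dsum ν z ≠ 0 := fun z hz =>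
    mul_ne_zero kR_ne_zero fun h => by have := hDz z hz; rw [h, norm_zero] at this; linarith
  have hk : 0 < kR := by unfold kR; positivity
  refine ⟨κ₁, CN / (kR * (((2 / Real.pi) ^ 5) ^ 2 / 2)), hκ₁, hκ₁0, by positivity, ?_, fun z hz => ?_, hDz⟩
  · have e : LamT s ν = fun z => Nsum s ν z * (((kR : ℝ) : ℂ) * Dsum ν z)⁻¹ := funext fun z => div_eq_mul_inv _ _
    rw [e]
    exact ((analyticOnNhd_Nsum_boxTube s ν (R := 9) (by norm_num)).differentiableOn.mono hsub).mul
      ((((analyticOnNhd_Dsum_boxTube ν (R := 9) (by norm_num)).differentiableOn.mono hsub).const_mul _).inv hDne)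
  · rw [LamT, norm_div, norm_mul, Complex.norm_real, Real.norm_of_nonneg hk.le]
    rw [div_le_div_iff₀ (mul_pos hk (lt_of_lt_of_le hc0 (hDz z hz))) (by positivity)]
    calc ‖Nsum s ν z‖ * (kR * (((2 / Real.pi) ^ 5) ^ 2 / 2)) ≤ CN * (kR * ‖Dsum ν z‖) :=
          mul_le_mul (hCN ν z (hsub hz)) (mul_le_mul_of_nonneg_left (hDz z hz) hk.le) (by positivity) hCN0
      _ = CN * (kR * ‖Dsum ν z‖) := rfl

end CorrectedMode

end

end Literature.MathematicalPhysics.QuantumFieldTheory.Federbush1986
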